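/-
Copyright: public-audit package `pub-balaban` (b2b-balaban), seat pv04-g11. Released under Apache 2.0 like Mathlib.
-/
import Literature.MathematicalPhysics.QuantumFieldTheory.Balaban1983to89.T4TiltOscillationRel
import Literature.MathematicalPhysics.QuantumFieldTheory.Balaban1983to89.T4BackgroundDeviation
import Literature.MathematicalPhysics.QuantumFieldTheory.Balaban1983to89.T4TiltModulusRelative

/-!
# T4RelativeTiltSize — the SIZING of the relative Gibbs tilt: `ε(u) ≤ C·dev(u)` with an EXPLICIT tiltSlope `C`, composed
# BY NAME from the three relative-coordinate leaves `T4TiltOscillationRel` (pv28-g7), `T4BackgroundDeviation`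
# (pv04-g10) and `T4TiltModulusRelative` (pv16-g10), and the consumer moduli of the (β)-node in the deviation currency
# (cell `pub-balaban`, T4-DAG v12 §5 row T4-O3.E-iii-b-G7-RELSIZE°, carved from GAPS G-pv28g6-1″; pv04 lineage share of
# the pv28 / pv04 / pv16 joint first refusal, gen 11; kernel bookkeeping, Mathlib + cell modules BY NAME)

HONEST FRAMING (cell `pub-balaban`, T4-DAG PAGE 1).  The cell's T4 target is the existence AND uniqueness of the
continuum limit of Bałaban's unit-scale averaged loop expectations on a finite torus — a constructive-QFT statement
strictly beyond ultraviolet stability ([Balaban1989LargeFieldII] Thm 1 p. 355); it is NOT the Yang–Mills mass gap and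
NOT the Clay problem.  This module is ELEMENTARY (finite sums, one exponential inequality, measure theory already in
the tree) and asserts NOTHING about Bałaban's papers: no statement of the series B1–B16 is quoted as a fact, used or
typed here, and NO ESTIMATE OF THE SERIES IS PROVED.  What it composes are three cell modules, each of which is itself
hypothesis-shaped.

WHAT IT DOES (row RELSIZE°, deliverables (1)–(3)).  The window's three relative-coordinate leaves read the
(S-TILT)/(LOG) smallness «`sup_k sup_u ε(u)/dev(u) < ∞`» (GAPS G-pv28g6-1′, G-pv28g6-1″) in three currencies: pv28-g7's
`T4TiltOscillationRel.reps` is FIRST ORDER in a LETTERWISE bound `D` on the relative bond deviations `rbdev` (exterior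
letters `u₀(b)⁻¹u(b)`, fibre letters the BACKGROUND deviation `(vΛ u₀ b)⁻¹ vΛ u b`; `reps_le_of_rbdev_le`); pv04-g10's
`T4BackgroundDeviation.BgDev s vΛ dom u₀ dev L` bounds the background letters by `L·dev u` on a domain `dom` of
exteriors, and its `FibreLip`/`norm_integral_condLaw_sub_le_of_bgDev` turn that into the (B-INS) charge
`LF·|s|·L·dev u` of a raw insert; pv16-g10's `T4TiltModulusRelative` consumes membership in the relative tilt domain
`tiltDom s (relDensity s vΛ old) u₀ κ ε ε₀` in the currency `ε`.  THIS MODULE COMPOSES THEM: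
* (1) §1–§2, THE SIZING.  With the exterior letters ALSO gauged by `dev` (`ExtDev s word dom u₀ dev L`, the exterior
  twin of `BgDev`; one common constant `L`, the smaller of two is lifted by `BgDev.mono` / `ExtDev.mono`) and a cut-off
  `dev u ≤ dev₀` linearising the quadratic term: `reps(u) ≤ tiltSlope · dev u` on `dom ∩ {dev ≤ dev₀}`
  (`reps_le_tiltSlope_mul_dev`) with THE EXPLICIT SLOPE
  `tiltSlope s c word η L dev₀ = Σ_{w_i meets s} |c_i|·(|w_i| L)·(η_i + |w_i| L dev₀/2)` (`tiltSlope`; for the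
  plaquette family
  `#{p : ∂p meets s}·|βw|·4L·(η₀ + 2L·dev₀)`, `tiltSlope_plaqWord`) — explicit in the window constants `η_i`, the
  deviation constant `L`, the cut-off `dev₀`, the weights and the word lengths, and in NOTHING ELSE: every dependence
  on Bałaban's level `k` can enter only through these named binders (the carver's «uniformly in k BY HYPOTHESIS
  SHAPE»).  Hence MEMBERSHIP in the relative tilt domain from `BgDev` + `ExtDev` + the window smallness
  `SmallOnRelWindow` + `tiltSlope·dev₀ ≤ ε₀`: with pv28's own `ε := reps` (`mem_tiltDom_rel_hsum_of_bgDev`) and with the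
  LINEAR `ε := tiltSlope·dev` (`mem_tiltDom_rel_hsum_linear`, the typed form of «`ε(u) ≤ C·dev(u)`»; `relWindow` form
  `mem_tiltDom_relWindow_hsum_linear`; the fully explicit sharp-relative-window Wilson instance
  `mem_tiltDom_relFibreWindow_wilson_linear`, in `SU(n)` `…_SU_linear`).  The currencies compose with NO loss
  beyond the factors `|w_i|`
  (letters per word, `4` for plaquettes) inside `tiltSlope` and `|s|` inside the (B-INS) charge — constants of the word
  family and of the fibre, which is the answer to the row's WHY-IT-MIGHT-FAIL: harmless unless a `k`-dependence hides
  in the word family or in `|s|` (a lattice constant for one-cube fibres).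
* (2) §3, THE CONSUMER MODULI IN THE DEVIATION CURRENCY.  On `dom ∩ {dev ≤ dev₀}` the conditional mean field of the
  (β)-node is `MeanLipschitz` with `dev := dev` (the node's own deviation gauge, `T4FirstOrderSize.MeanLipschitz`):
  for RELATIVE inserts (pv16's `relInsert`, no (B-INS) charge) with `lip = 2e^{2ε₀}·M·tiltSlope`
  (`meanLipschitz_relInsert_of_bgDev`, pv16's `meanLipschitz_of_relTilt` BY NAME + the rescaling
  `meanLipschitz_rescale`); for RAW fibre-Lipschitz inserts with `lip = 2e^{2ε₀}·M·tiltSlope + LF·|s|·L`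
  (`meanLipschitz_raw_of_bgDev`, pv04's `norm_integral_condLaw_sub_le_of_bgDev` BY NAME) — the D-charged modulus of
  pv16's `meanLipschitz_of_relTilt_raw` («`lip = 2e^{2ε₀}M + L′`») read in the deviation currency: `2e^{2ε₀}M` becomes
  `2e^{2ε₀}M·tiltSlope` through `ε ≤ tiltSlope·dev`, and `L′ = LF·|s|·L` is pv04's (B-INS) constant.  LOCATED
  (docstring of
  `meanLipschitz_raw_of_bgDev`): pv16's `meanLipschitz_of_relTilt_raw` itself is NOT instantiated by name, because its
  `hD` binder is posed on the WHOLE tilt domain in the currency `ε u`, whereas `BgDev` lives on `dom` in the currency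
  `dev u` (and `ε = reps` may vanish where `dev` does not); the composed theorem is proved from the same two
  ingredients pointwise on `dom ∩ {dev ≤ dev₀}` — same mathematics, honest domain.  `CondMeanSuppression` follows from
  `MeanVanishes` at `u₀` by `condMeanSuppression_of_flat` (`condMeanSuppression_relInsert_of_bgDev`,
  `condMeanSuppression_raw_of_bgDev`).
* (3) §4, NON-VACUITY / THE RAW TOY `vΛ ≡ 1`.  With the trivial background `BgDev` is free (`bgDev_one`), the relative
  objects are the raw ones (`relDensity_one`, `reps_bg_self`, `rkappa_bg_self`) and THE SAME `tiltSlope` sizes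
  pv28's raw
  `eps` (`eps_le_tiltSlope_mul`, `mem_tiltDom_hsum_linear_raw`): the constant of G7-LOG*'s `eps_le_of_bdev_le` with its
  quadratic term linearised by `dev₀` — the relative sizing REDUCES to the raw one, so the composition costs nothing at
  `vΛ ≡ 1`.  NON-VACUITY OF THE CHAIN: with the toy gauge `totDev u₀ u = Σ_b |u₀(b)⁻¹u(b) − 1|` (`ExtDev` with `L = 1`
  for free, `extDev_totDev`) every exterior with `totDev ≤ dev₀` and an exterior-blind window lies in the raw tilt
  domain, the window smallness and `tiltSlope·dev₀ ≤ ε₀` being the only hypotheses left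
  (`mem_tiltDom_hsum_linear_totDev`);
  `self_mem_tiltDom_linear`: the reference exterior always lies in the linear tilt domain.

## WHAT IS NOT PROVED / NOT PRINTED (records `t4/T4-EST-O3Eiiib-G7.md` (pv28 one-writer) §0/§2bis, `t4/T4-EST-O3Ei.md`
v1.2 §8 (pv04); GAPS G-pv28g6-1, -1′, -1″, G-pv28g7-1, -2, G-pv04g10-1)

* THE ESTIMATE.  What of G-pv28g6-1″ is now KERNEL-ON-HYPOTHESES: «`ε(u) ≤ C·dev(u)` on `dom ∩ {dev ≤ dev₀}` with `C`
  explicit and level-independent GIVEN level-independent inputs».  What REMAINS THE ESTIMATE, untouched and not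
  asserted: (i) `BgDev` with a `k`-uniform `L` for Bałaban's backgrounds `V_Λ = M^k(U₀)` ([IV] p. 197) — pv04-g10's
  analytic supplier `bgDev_of_segment` reduces it to a `k`-uniform analyticity slice `(B, α₁)` of [IV] Prop. 1's
  window (rows Oβ3-t1-REG° / BGDEV* (R)), NOT discharged; (ii) `ExtDev`, i.e. the identification of the deviation
  gauge `dev` of the (β)-node with (a multiple of) the exterior bond deviations — a cell modelling choice, free in the
  raw toy, NOT read off a printed page; (iii) the window smallness `η` and the side condition `tiltSlope·dev₀ ≤ ε₀`
  against `g_k^{−2}`, window radii and logarithms (caveats (LOG-SIZE)/(LOG-SIZE-REL) of the pv28 modules stand);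
  (iv) the count `#{p : ∂p meets s}` (interior plaquettes included, pv28-g7's (LOG-SIZE-REL)) and `|s|` as absolute
  lattice constants — true for one-cube fibres, not typed here.
* Existence, measurability and `FieldIndep` of Bałaban's `V_Λ`, `V^{(k)}` are HYPOTHESES (`hv : FieldIndep s vΛ`, U1a
  inputs), exactly as in the three composed modules; the δ-function factors of the printed densities are not modelled
  (DIVERGENCE F7 standing); `ReTrQuad G` stays the hypothesis SHAPE of `T4TiltOscillation` §1, discharged there for
  `U(n)` / `SU(n)`; `MeanVanishes` at `u₀` (row (α)/K) is an input of the suppression corollaries, not touched.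
* NO new reading of any page of [I]/[IV]/[V] is made here; the citation header below only locates the objects the three
  composed modules model, with the page references THEY give.

CITATION HEADER (lean-in-tree rule 2026-08-18).  T. Bałaban, *Renormalization group approach to lattice gauge field
theories. I*, Comm. Math. Phys. **109**, 249–301 (1987) [Balaban1987RG1] (cell paper B12 = [I]; held text
`paper:balaban1987-cmp109-rg-i-small-field`, journal page = PDF page + 248: p. 265 relative variables
`V′ = V(V^{(k)})⁻¹`, quoted by `T4CondLawRelative` / `T4TiltModulusRelative`); T. Bałaban, *Large field
renormalization. I. The basic step of the 𝐑 operation*, Comm. Math. Phys. **122**, 175–202 (1989)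
[Balaban1989LargeFieldI] (B15 = [IV]; held `paper:balaban1989-cmp122-large-field-i`, journal page = PDF page + 174:
Prop. 1 p. 194 (analyticity window — the SHAPE behind `BgDev`/`MeanLipschitz`), (1.100)/(1.101) p. 201 (relative
windows), p. 197 (`V_Λ = M^k(U₀)`), quoted by `T4BackgroundDeviation` / `T4FirstOrderSize` / `T4CondLawRelative`);
T. Bałaban, *Large field renormalization. II*, Comm. Math. Phys. **122**, 355–392 (1989) [Balaban1989LargeFieldII]
(B16 = [V]; Thm 1 p. 355 = the UV-stability statement the HONEST FRAMING refers to).  All three are manuscripts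
UNDER ADJUDICATION by the audit cell; they are cited as LOCATIONS of shapes only, never as facts, and no sentence of
theirs is used in a proof below.

DICTIONARY (as in the three composed modules).  `s` = the integrated bond variables (the fibre); `u u₀ : GaugeField`
= exteriors, `u₀` the reference; `vΛ` with `FieldIndep s vΛ` = the background `V^{(k)}` / `V_Λ` as a functional of
the exterior; `dom : Set GaugeField`, `dev : GaugeField → ℝ` = the (β)-node's domain and deviation gauge
(`T4FirstOrderSize.MeanLipschitz dom m S u₀ dev lip`); `L` = the common first-order constant of `BgDev` (background
letters) and `ExtDev` (exterior letters); `η_i` = the window smallness of the words meeting `s` (`SmallOnRelWindow`);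
`dev₀` = the cut-off linearising `reps`' quadratic term; `ε₀` = the tilt ceiling of `tiltDom`; `tiltSlope` = the `C` of
«`ε ≤ C·dev`»; `LF` = a fibre-Lipschitz constant of a raw insert (`FibreLip`), `M` its oscillation bound.

CONTENTS (every declaration [folklore]; nothing of another module modified).
* §1 `ExtDev` (+ `ExtDev.mono`, `extDev_of_forall`; the toy gauge `totDev`, `totDev_nonneg`, `dist1_bdev_le_totDev`,
  `extDev_totDev`), `rbdev_le_of_bgDev_extDev` (pv01-g11's composite probe, named),
  `tiltSlope`, `tiltSlope_nonneg`, `tiltSlope_plaqWord`, `lin_aux`, THE SIZING `reps_le_tiltSlope_mul` /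
  `reps_le_tiltSlope_mul_dev` /
  `reps_le_ceiling`.
* §2 `ratioClose_mono`, `mem_tiltDom_of_eps_le` (the tilt domain is monotone in `ε` below the ceiling),
  `mem_tiltDom_rel_hsum_of_bgDev`, `mem_tiltDom_rel_hsum_linear`, `mem_tiltDom_relWindow_hsum_linear`,
  `mem_tiltDom_relFibreWindow_wilson_linear` (+ `_SU`), `self_mem_tiltDom_linear`.
* §3 `meanLipschitz_rescale`, `meanLipschitz_relInsert_of_bgDev`, `condMeanSuppression_relInsert_of_bgDev`,
  `meanLipschitz_raw_of_bgDev`, `condMeanSuppression_raw_of_bgDev`.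
* §4 the raw toy: `eps_le_tiltSlope_mul`, `mem_tiltDom_hsum_linear_raw`, `mem_tiltDom_hsum_linear_totDev`.
Depends on `T4TiltOscillationRel` (pv28-g7: `rbdev`, `rbdev_le_of_bdev_le`, `reps`, `rkappa`,
`reps_le_of_rbdev_le`, `reps_nonneg`, `reps_bg_self`, `rkappa_bg_self`, `SmallOnRelWindow`, `mem_tiltDom_rel_hsum`,
`fibreRatioClose_rel_hsum`, `sharpWindow`, `sharpWindow_nonneg`, `mem_tiltDom_relFibreWindow_wilson`),
`T4TiltOscillation` (pv28: `ReTrQuad`, `Letter`, `bdev`, `Meets`, `hsum`, `eps`, `kappa`, `plaqWord`,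
`length_plaqWord`, `SmallOnWindow`, `reTrQuad_specialUnitaryGroup`), `T4BackgroundDeviation` (pv04-g10: `BgDev`,
`BgDev.mono`, `bgDev_one`, `FibreLip`, `norm_integral_condLaw_sub_le_of_bgDev`), `T4TiltModulusRelative` (pv16-g10:
`relInsert`, `meanLipschitz_of_relTilt`), `T4CondLawRelative` (pv04-g10: `onFibre`, `relDensity`, `relDensity_nonneg`,
`relDensity_one`, `relWindow`, `relWindow_updateFinset_mul`), `T4TiltModulus` (pv16-g9: `RatioClose`, `tiltDom`,
`self_mem_tiltDom`, `exp_two_mul_sub_one_le`), `T4FirstOrderSize` (pv16-g6: `MeanLipschitz`, `MeanVanishes`,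
`CondMeanSuppression`, `condMeanSuppression_of_flat`), `T4FibreTranslate` (b01: `FieldIndep`, `FieldIndep.const`),
`T4DressingDefect` (pv04: `condLaw`, `fibreIntegral`, `fibreBase`), and Mathlib.  All declarations [folklore]; no
`[cite:]`.  v1 (this file): new leaf, no declaration of another module changed.
-/

noncomputable section

open _root_.MeasureTheory
open Function (updateFinset)
open scoped BigOperators

namespace Literature.MathematicalPhysics.QuantumFieldTheory.Balaban1983to89.T4RelativeTiltSize

open Literature.MathematicalPhysics.QuantumFieldTheory.Balaban1983to89
open B15.BasicStep T4DressedR T4DressingDefect T4FirstOrderSize T4FibreTranslate T4TiltModulus T4CondLawRelative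
  T4TiltOscillation T4TiltOscillationRel T4BackgroundDeviation T4TiltModulusRelative

/-! ## §1  The exterior twin of `BgDev`, the explicit tiltSlope, and the sizing `reps ≤ tiltSlope · dev` -/

section Sizing

variable {P : Params} {j : ℕ} {G : Type*} [GaugeGroup G] {ι : Type*}

/-- HYPOTHESIS SHAPE `ExtDev` — the EXTERIOR twin of pv04's `BgDev`: on the domain `dom` the exterior `u` deviates
from the reference `u₀` on every EXTERIOR letter of the words meeting the fibre by at most `L · dev u` in the group's
`|· − 1|` (`dist1 (u₀(b)⁻¹ u(b)) ≤ L · dev u`).  This identifies the (β)-node's deviation gauge `dev` with (a multiple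
of) the exterior bond deviations read by pv28's `eps`/`reps`; a cell modelling hypothesis, nothing printed asserted.
[folklore] -/
def ExtDev (s : Finset (PBond P j)) (word : ι → List (Letter P j)) (dom : Set (GaugeField P j G))
    (u₀ : GaugeField P j G) (dev : GaugeField P j G → ℝ) (L : ℝ) : Prop :=
  ∀ u ∈ dom, ∀ i, Meets s (word i) → ∀ c ∈ word i, c.1 ∉ s → dist1 (bdev u u₀ c.1) ≤ L * dev u

/-- Monotonicity of `ExtDev` in the constant (for a non-negative deviation gauge). [folklore] -/
theorem ExtDev.mono {s : Finset (PBond P j)} {word : ι → List (Letter P j)} {dom : Set (GaugeField P j G)}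
    {u₀ : GaugeField P j G} {dev : GaugeField P j G → ℝ} {L L' : ℝ} (h : ExtDev s word dom u₀ dev L) (hL : L ≤ L')
    (hdev : ∀ u ∈ dom, 0 ≤ dev u) : ExtDev s word dom u₀ dev L' :=
  fun u hu i hi c hc hc1 => (h u hu i hi c hc hc1).trans (mul_le_mul_of_nonneg_right hL (hdev u hu))

/-- SUPPLIER: a bound on ALL exterior bonds gives `ExtDev` for every word family. [folklore] -/
theorem extDev_of_forall {s : Finset (PBond P j)} (word : ι → List (Letter P j)) {dom : Set (GaugeField P j G)}
    {u₀ : GaugeField P j G} {dev : GaugeField P j G → ℝ} {L : ℝ}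
    (h : ∀ u ∈ dom, ∀ b ∉ s, dist1 (bdev u u₀ b) ≤ L * dev u) : ExtDev s word dom u₀ dev L :=
  fun u hu _ _ c _ hc1 => h u hu c.1 hc1

/-- THE TOTAL EXTERIOR DEVIATION `Σ_b |u₀(b)⁻¹u(b) − 1|` over all bonds of the torus — a deviation gauge for which
`ExtDev` holds with `L = 1` on every domain and for every word family (non-vacuity of the shape; a cell toy gauge,
nothing printed asserted). [folklore] -/
def totDev (u₀ u : GaugeField P j G) : ℝ := ∑ b, dist1 (bdev u u₀ b)

/-- `0 ≤ totDev`. [folklore] -/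
theorem totDev_nonneg (u₀ u : GaugeField P j G) : 0 ≤ totDev u₀ u :=
  Finset.sum_nonneg fun b _ => GaugeGroup.dist1_nonneg (bdev u u₀ b)

/-- Each bond deviation is dominated by the total one. [folklore] -/
theorem dist1_bdev_le_totDev (u₀ u : GaugeField P j G) (b : PBond P j) : dist1 (bdev u u₀ b) ≤ totDev u₀ u :=
  Finset.single_le_sum (f := fun b => dist1 (bdev u u₀ b)) (fun b _ => GaugeGroup.dist1_nonneg (bdev u u₀ b))
    (Finset.mem_univ b)

/-- NON-VACUITY OF `ExtDev`: with the total exterior deviation as gauge, `ExtDev s word dom u₀ (totDev u₀) 1` for every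
fibre, word family, domain and reference. [folklore] -/
theorem extDev_totDev (s : Finset (PBond P j)) (word : ι → List (Letter P j)) (dom : Set (GaugeField P j G))
    (u₀ : GaugeField P j G) : ExtDev s word dom u₀ (totDev u₀) 1 :=
  extDev_of_forall word fun u _ b _ => by rw [one_mul]; exact dist1_bdev_le_totDev u₀ u b

variable [DecidableEq (PBond P j)]

/-- ONE LETTER, TWO MODULES (pv01-g11's composite probe, named): `BgDev` on the fibre letters and `ExtDev` on the
exterior letters give the letterwise hypothesis of pv28's `reps_le_of_rbdev_le` in the common gauge `L · dev u`
(`rbdev_le_of_bdev_le`). [folklore] -/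
theorem rbdev_le_of_bgDev_extDev {s : Finset (PBond P j)} {word : ι → List (Letter P j)}
    {vΛ : GaugeField P j G → GaugeField P j G} {dom : Set (GaugeField P j G)} {u₀ : GaugeField P j G}
    {dev : GaugeField P j G → ℝ} {L : ℝ} (hbg : BgDev s vΛ dom u₀ dev L) (hext : ExtDev s word dom u₀ dev L)
    {u : GaugeField P j G} (hu : u ∈ dom) :
    ∀ i, Meets s (word i) → ∀ c ∈ word i, dist1 (rbdev s u u₀ (vΛ u) (vΛ u₀) c.1) ≤ L * dev u :=
  fun i hi c hc => rbdev_le_of_bdev_le s u u₀ (vΛ u) (vΛ u₀) (fun hc1 => hext u hu i hi c hc hc1)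
    (fun hc1 => hbg u hu c.1 hc1)

variable [Fintype ι]

/-- **THE EXPLICIT SLOPE** `C` of «`ε(u) ≤ C · dev(u)`»:
`tiltSlope = Σ_{w_i meets s} |c_i| · (|w_i| L) · (η_i + |w_i| L dev₀ / 2)` — pv28's first-order coefficient
`Σ_{mixed} |c_i| η_i |w_i|` times the deviation constant `L`, plus the quadratic term of `reps` linearised by the
cut-off `dev₀`.  Explicit in the window constants `η_i`, `L`, `dev₀`, the weights and the word lengths; NO other
parameter. [folklore] -/
def tiltSlope (s : Finset (PBond P j)) (c : ι → ℝ) (word : ι → List (Letter P j)) (η : ι → ℝ) (L dev₀ : ℝ) : ℝ :=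
  ∑ i, if Meets s (word i) then |c i| * ((word i).length * L) * (η i + (word i).length * L * dev₀ / 2) else 0

/-- `0 ≤ tiltSlope` for `η ≥ 0`, `L ≥ 0`, `dev₀ ≥ 0`. [folklore] -/
theorem tiltSlope_nonneg (s : Finset (PBond P j)) (c : ι → ℝ) (word : ι → List (Letter P j)) {η : ι → ℝ}
    (hη0 : ∀ i, 0 ≤ η i) {L dev₀ : ℝ} (hL : 0 ≤ L) (hd₀ : 0 ≤ dev₀) : 0 ≤ tiltSlope s c word η L dev₀ := by
  refine Finset.sum_nonneg fun i _ => ?_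
  split_ifs
  · have hn : (0 : ℝ) ≤ (word i).length := Nat.cast_nonneg _
    exact mul_nonneg (mul_nonneg (abs_nonneg _) (mul_nonneg hn hL))
      (add_nonneg (hη0 i) (div_nonneg (mul_nonneg (mul_nonneg hn hL) hd₀) zero_le_two))
  · exact le_rfl

/-- THE SLOPE OF THE PLAQUETTE FAMILY with constant weight `a` and constant window smallness `η₀`:
`tiltSlope = #{p : ∂p meets s} · (|a| · 4L · (η₀ + 4 L dev₀ / 2))` — the count runs over ALL plaquettes meeting `s`, the
ones inside the fibre region included (pv28-g7's (LOG-SIZE-REL)). [folklore] -/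
theorem tiltSlope_plaqWord (s : Finset (PBond P j)) (a η₀ L dev₀ : ℝ) :
    tiltSlope s (fun _ : Plaq P j => a) plaqWord (fun _ => η₀) L dev₀
      = (Finset.univ.filter fun p : Plaq P j => Meets s (plaqWord p)).card
          * (|a| * (4 * L) * (η₀ + 4 * L * dev₀ / 2)) := by
  unfold tiltSlope
  simp only [length_plaqWord, Nat.cast_ofNat]
  rw [Finset.sum_ite, Finset.sum_const_zero, add_zero, Finset.sum_const, nsmul_eq_mul]

/-- An elementary linearisation: for `0 ≤ a`, `0 ≤ d ≤ dev₀`,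
`η·(a d) + (a d)²/2 ≤ a·(η + a·dev₀/2)·d`. [folklore] -/
theorem lin_aux {a d dev₀ η : ℝ} (ha : 0 ≤ a) (hd : 0 ≤ d) (hd₀ : d ≤ dev₀) :
    η * (a * d) + (a * d) ^ 2 / 2 ≤ a * (η + a * dev₀ / 2) * d := by
  have h3 : a * a * d * d ≤ a * a * d * dev₀ := mul_le_mul_of_nonneg_left hd₀ (mul_nonneg (mul_nonneg ha ha) hd)
  nlinarith [h3]

/-- **THE SIZING OF THE RELATIVE TILT (letterwise form).**  Under a letterwise bound
`dist1 (rbdev …) ≤ L · d` on the letters of the words meeting `s` (`0 ≤ L`, `0 ≤ d ≤ dev₀`):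
`reps ≤ tiltSlope · d` — pv28's `reps_le_of_rbdev_le` with `D := L·d` and the quadratic term linearised. [folklore] -/
theorem reps_le_tiltSlope_mul (s : Finset (PBond P j)) (c : ι → ℝ) (word : ι → List (Letter P j)) {η : ι → ℝ}
    (hη0 : ∀ i, 0 ≤ η i) (u u₀ v v₀ : GaugeField P j G) {L d dev₀ : ℝ} (hL : 0 ≤ L) (hd : 0 ≤ d) (hd₀ : d ≤ dev₀)
    (hD : ∀ i, Meets s (word i) → ∀ c' ∈ word i, dist1 (rbdev s u u₀ v v₀ c'.1) ≤ L * d) :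
    reps s c word η u u₀ v v₀ ≤ tiltSlope s c word η L dev₀ * d := by
  refine (reps_le_of_rbdev_le s c word hη0 u u₀ v v₀ hD).trans ?_
  rw [tiltSlope, Finset.sum_mul]
  refine Finset.sum_le_sum fun i _ => ?_
  split_ifs with hm
  · have hn : (0 : ℝ) ≤ (word i).length := Nat.cast_nonneg _
    have key := lin_aux (η := η i) (mul_nonneg hn hL) hd hd₀
    calc |c i| * (η i * ((word i).length * (L * d)) + ((word i).length * (L * d)) ^ 2 / 2)
        = |c i| * (η i * ((word i).length * L * d) + ((word i).length * L * d) ^ 2 / 2) := by ring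
      _ ≤ |c i| * ((word i).length * L * (η i + (word i).length * L * dev₀ / 2) * d) :=
          mul_le_mul_of_nonneg_left key (abs_nonneg _)
      _ = |c i| * ((word i).length * L) * (η i + (word i).length * L * dev₀ / 2) * d := by ring
  · simp

/-- **THE SIZING OF THE RELATIVE TILT (row RELSIZE° (1)).**  Under `BgDev s vΛ dom u₀ dev L` (pv04: background
letters), `ExtDev s word dom u₀ dev L` (exterior letters), `0 ≤ L`, `0 ≤ dev` on `dom`: for every `u ∈ dom` with
`dev u ≤ dev₀`, `reps … u u₀ (vΛ u) (vΛ u₀) ≤ tiltSlope · dev u` — the typed form of «`sup_u ε(u)/dev(u) ≤ C` on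
`dom ∩ {dev ≤ dev₀}`», `C = tiltSlope s c word η L dev₀`. [folklore] -/
theorem reps_le_tiltSlope_mul_dev (s : Finset (PBond P j)) (c : ι → ℝ) (word : ι → List (Letter P j)) {η : ι → ℝ}
    (hη0 : ∀ i, 0 ≤ η i) {vΛ : GaugeField P j G → GaugeField P j G} {dom : Set (GaugeField P j G)}
    {u₀ : GaugeField P j G} {dev : GaugeField P j G → ℝ} {L dev₀ : ℝ} (hL : 0 ≤ L) (hbg : BgDev s vΛ dom u₀ dev L)
    (hext : ExtDev s word dom u₀ dev L) (hdev : ∀ u ∈ dom, 0 ≤ dev u) {u : GaugeField P j G} (hu : u ∈ dom)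
    (hd : dev u ≤ dev₀) : reps s c word η u u₀ (vΛ u) (vΛ u₀) ≤ tiltSlope s c word η L dev₀ * dev u :=
  reps_le_tiltSlope_mul s c word hη0 u u₀ (vΛ u) (vΛ u₀) hL (hdev u hu) hd (rbdev_le_of_bgDev_extDev hbg hext hu)

/-- … and below the tilt ceiling: `tiltSlope · dev u ≤ ε₀` and `reps ≤ ε₀` as soon as `tiltSlope · dev₀ ≤ ε₀`.
[folklore] -/
theorem reps_le_ceiling (s : Finset (PBond P j)) (c : ι → ℝ) (word : ι → List (Letter P j)) {η : ι → ℝ}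
    (hη0 : ∀ i, 0 ≤ η i) {vΛ : GaugeField P j G → GaugeField P j G} {dom : Set (GaugeField P j G)}
    {u₀ : GaugeField P j G} {dev : GaugeField P j G → ℝ} {L dev₀ ε₀ : ℝ} (hL : 0 ≤ L)
    (hbg : BgDev s vΛ dom u₀ dev L) (hext : ExtDev s word dom u₀ dev L) (hdev : ∀ u ∈ dom, 0 ≤ dev u)
    (hε₀ : tiltSlope s c word η L dev₀ * dev₀ ≤ ε₀) {u : GaugeField P j G} (hu : u ∈ dom) (hd : dev u ≤ dev₀) :
    tiltSlope s c word η L dev₀ * dev u ≤ ε₀ ∧ reps s c word η u u₀ (vΛ u) (vΛ u₀) ≤ ε₀ := by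
  have h1 := reps_le_tiltSlope_mul_dev s c word hη0 hL hbg hext hdev hu hd
  have h2 : tiltSlope s c word η L dev₀ * dev u ≤ tiltSlope s c word η L dev₀ * dev₀ :=
    mul_le_mul_of_nonneg_left hd (tiltSlope_nonneg s c word hη0 hL ((hdev u hu).trans hd))
  exact ⟨h2.trans hε₀, h1.trans (h2.trans hε₀)⟩

end Sizing

/-! ## §2  Membership in the relative tilt domain with the LINEAR `ε := tiltSlope · dev` -/

section Membership

variable {P : Params} {j : ℕ} {G : Type*} [GaugeGroup G] {ι : Type*} [Fintype ι] [DecidableEq (PBond P j)]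

/-- `RatioClose` is monotone in the oscillation against a non-negative reference density. [folklore] -/
theorem ratioClose_mono {S : Type*} {κ ε ε' : ℝ} {p₁ p₂ : S → ℝ} (h : RatioClose κ ε p₁ p₂) (hε : ε ≤ ε')
    (hp₂ : ∀ x, 0 ≤ p₂ x) : RatioClose κ ε' p₁ p₂ := fun x => by
  obtain ⟨h1, h2⟩ := h x
  exact ⟨(mul_le_mul_of_nonneg_right (Real.exp_le_exp.mpr (by linarith)) (hp₂ x)).trans h1,
    h2.trans (mul_le_mul_of_nonneg_right (Real.exp_le_exp.mpr (by linarith)) (hp₂ x))⟩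

omit [GaugeGroup G] in
/-- pv16-g9's tilt domain is MONOTONE IN `ε` BELOW THE CEILING (for a non-negative density): membership with
`ε u ≤ ε' u ≤ ε₀` upgrades to membership with `ε'`. [folklore] -/
theorem mem_tiltDom_of_eps_le (s : Finset (PBond P j)) {old : Density P j G} (h0 : ∀ U, 0 ≤ old U)
    {u u₀ : GaugeField P j G} {κ ε ε' : GaugeField P j G → ℝ} {ε₀ : ℝ} (hu : u ∈ tiltDom s old u₀ κ ε ε₀)
    (hε : ε u ≤ ε' u) (hε' : ε' u ≤ ε₀) : u ∈ tiltDom s old u₀ κ ε' ε₀ := by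
  obtain ⟨hR, h0ε, -⟩ := hu
  exact ⟨ratioClose_mono hR hε fun y => h0 (updateFinset u₀ s y), h0ε.trans hε, hε'⟩

/-- **MEMBERSHIP IN THE RELATIVE TILT DOMAIN FROM `BgDev` + `ExtDev` (pv28's own `ε := reps`).**  Under `ReTrQuad G`,
for `old = χ·e^{h}`, `h = Σ_i c_i Re tr U(w_i)`, a fibre-independent background `vΛ`, a window exterior-blind along
the relative fibres through `u`, `u₀` (`hχ`) with smallness `SmallOnRelWindow` at `u₀`, and the deviation hypotheses
`BgDev`/`ExtDev` with `tiltSlope · dev₀ ≤ ε₀`: every `u ∈ dom` with `dev u ≤ dev₀` lies in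
`tiltDom s (relDensity s vΛ old) u₀ rkappa reps ε₀` (pv28's `mem_tiltDom_rel_hsum`, its `hε` DISCHARGED by §1).
[folklore] -/
theorem mem_tiltDom_rel_hsum_of_bgDev (hq : ReTrQuad G) (s : Finset (PBond P j))
    {vΛ : GaugeField P j G → GaugeField P j G} (hv : FieldIndep s vΛ) {χ : Density P j G} (hχ0 : ∀ U, 0 ≤ χ U)
    (c : ι → ℝ) (word : ι → List (Letter P j)) {η : ι → ℝ} (hη0 : ∀ i, 0 ≤ η i)
    {dom : Set (GaugeField P j G)} {u₀ : GaugeField P j G} {dev : GaugeField P j G → ℝ} {L dev₀ ε₀ : ℝ}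
    (hL : 0 ≤ L) (hbg : BgDev s vΛ dom u₀ dev L) (hext : ExtDev s word dom u₀ dev L) (hdev : ∀ u ∈ dom, 0 ≤ dev u)
    (hW : SmallOnRelWindow s vΛ χ word η u₀) (hε₀ : tiltSlope s c word η L dev₀ * dev₀ ≤ ε₀) {u : GaugeField P j G}
    (hu : u ∈ dom) (hd : dev u ≤ dev₀)
    (hχ : ∀ y : s → G,
      χ (updateFinset u s (y * onFibre s (vΛ u))) = χ (updateFinset u₀ s (y * onFibre s (vΛ u₀)))) :
    u ∈ tiltDom s (relDensity s vΛ fun U => χ U * Real.exp (hsum c word U)) u₀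
      (fun u => rkappa s c word u u₀ (vΛ u) (vΛ u₀)) (fun u => reps s c word η u u₀ (vΛ u) (vΛ u₀)) ε₀ :=
  mem_tiltDom_rel_hsum hq s hv hχ0 c word hη0 hχ hW (reps_le_ceiling s c word hη0 hL hbg hext hdev hε₀ hu hd).2

/-- **MEMBERSHIP WITH THE LINEAR OSCILLATION `ε := tiltSlope · dev` (row RELSIZE° (1), the typed «`ε(u) ≤ C·dev(u)`»).**
Same data: `u ∈ tiltDom s (relDensity s vΛ old) u₀ rkappa (fun u => tiltSlope · dev u) ε₀`. [folklore] -/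
theorem mem_tiltDom_rel_hsum_linear (hq : ReTrQuad G) (s : Finset (PBond P j))
    {vΛ : GaugeField P j G → GaugeField P j G} (hv : FieldIndep s vΛ) {χ : Density P j G} (hχ0 : ∀ U, 0 ≤ χ U)
    (c : ι → ℝ) (word : ι → List (Letter P j)) {η : ι → ℝ} (hη0 : ∀ i, 0 ≤ η i)
    {dom : Set (GaugeField P j G)} {u₀ : GaugeField P j G} {dev : GaugeField P j G → ℝ} {L dev₀ ε₀ : ℝ}
    (hL : 0 ≤ L) (hbg : BgDev s vΛ dom u₀ dev L) (hext : ExtDev s word dom u₀ dev L) (hdev : ∀ u ∈ dom, 0 ≤ dev u)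
    (hW : SmallOnRelWindow s vΛ χ word η u₀) (hε₀ : tiltSlope s c word η L dev₀ * dev₀ ≤ ε₀) {u : GaugeField P j G}
    (hu : u ∈ dom) (hd : dev u ≤ dev₀)
    (hχ : ∀ y : s → G,
      χ (updateFinset u s (y * onFibre s (vΛ u))) = χ (updateFinset u₀ s (y * onFibre s (vΛ u₀)))) :
    u ∈ tiltDom s (relDensity s vΛ fun U => χ U * Real.exp (hsum c word U)) u₀
      (fun u => rkappa s c word u u₀ (vΛ u) (vΛ u₀)) (fun u => tiltSlope s c word η L dev₀ * dev u) ε₀ :=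
  mem_tiltDom_of_eps_le s (ε' := fun u => tiltSlope s c word η L dev₀ * dev u)
    (relDensity_nonneg s vΛ fun U => mul_nonneg (hχ0 U) (Real.exp_pos _).le)
    (mem_tiltDom_rel_hsum_of_bgDev hq s hv hχ0 c word hη0 hL hbg hext hdev hW hε₀ hu hd hχ)
    (reps_le_tiltSlope_mul_dev s c word hη0 hL hbg hext hdev hu hd)
    (reps_le_ceiling s c word hη0 hL hbg hext hdev hε₀ hu hd).1

/-- THE `relWindow` FORM: for `old = relWindow s vΛ w · e^{h}` the window hypothesis `hχ` holds by construction
(pv04's `relWindow_updateFinset_mul`), at EVERY `u`. [folklore] -/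
theorem mem_tiltDom_relWindow_hsum_linear (hq : ReTrQuad G) (s : Finset (PBond P j))
    {vΛ : GaugeField P j G → GaugeField P j G} (hv : FieldIndep s vΛ) {w : (s → G) → ℝ} (hw : ∀ y, 0 ≤ w y)
    (c : ι → ℝ) (word : ι → List (Letter P j)) {η : ι → ℝ} (hη0 : ∀ i, 0 ≤ η i)
    {dom : Set (GaugeField P j G)} {u₀ : GaugeField P j G} {dev : GaugeField P j G → ℝ} {L dev₀ ε₀ : ℝ}
    (hL : 0 ≤ L) (hbg : BgDev s vΛ dom u₀ dev L) (hext : ExtDev s word dom u₀ dev L) (hdev : ∀ u ∈ dom, 0 ≤ dev u)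
    (hW : SmallOnRelWindow s vΛ (relWindow s vΛ w) word η u₀) (hε₀ : tiltSlope s c word η L dev₀ * dev₀ ≤ ε₀)
    {u : GaugeField P j G} (hu : u ∈ dom) (hd : dev u ≤ dev₀) :
    u ∈ tiltDom s (relDensity s vΛ fun U => relWindow s vΛ w U * Real.exp (hsum c word U)) u₀
      (fun u => rkappa s c word u u₀ (vΛ u) (vΛ u₀)) (fun u => tiltSlope s c word η L dev₀ * dev u) ε₀ :=
  mem_tiltDom_rel_hsum_linear hq s hv (χ := relWindow s vΛ w) (fun U => hw _) c word hη0 hL hbg hext hdev hW hε₀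
    hu hd (fun y => by rw [relWindow_updateFinset_mul s hv, relWindow_updateFinset_mul s hv])

/-- **THE FULLY EXPLICIT INSTANCE** (pv28-g7's `mem_tiltDom_relFibreWindow_wilson` with its `hε` DISCHARGED): under
`ReTrQuad G`, for the sharp-relative-window Wilson density `old = relWindow s vΛ (sharpWindow s r) · e^{−βA_w}`, a
fibre-independent background, a reference exterior `r`-close to `1` on the exterior letters of the plaquettes meeting
`s` and a reference background `r₀`-close to `1` on `s` (window smallness `η ≡ 4(r + r₀)`), the deviation hypotheses
`BgDev`/`ExtDev` with constant `L` and the side condition `tiltSlope · dev₀ ≤ ε₀` with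
`tiltSlope = #{p : ∂p meets s}·|βw|·4L·(4(r + r₀) + 2L dev₀)` (`tiltSlope_plaqWord`): EVERY `u ∈ dom` with
`dev u ≤ dev₀` lies in the relative tilt domain with the LINEAR `ε := tiltSlope · dev`. [folklore] -/
theorem mem_tiltDom_relFibreWindow_wilson_linear (hq : ReTrQuad G) (s : Finset (PBond P j))
    {vΛ : GaugeField P j G → GaugeField P j G} (hv : FieldIndep s vΛ) {r r₀ : ℝ} (hr : 0 ≤ r) (hr0 : 0 ≤ r₀)
    (β w : ℝ) {dom : Set (GaugeField P j G)} {u₀ : GaugeField P j G} {dev : GaugeField P j G → ℝ} {L dev₀ ε₀ : ℝ}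
    (hL : 0 ≤ L) (hbg : BgDev s vΛ dom u₀ dev L) (hext : ExtDev s plaqWord dom u₀ dev L)
    (hdev : ∀ u ∈ dom, 0 ≤ dev u) (hbg₀ : ∀ b ∈ s, dist1 (vΛ u₀ b) ≤ r₀)
    (hext₀ : ∀ p : Plaq P j, Meets s (plaqWord p) → ∀ c ∈ plaqWord p, c.1 ∉ s → dist1 (u₀ c.1) ≤ r)
    (hε₀ : tiltSlope s (fun _ => β * w) plaqWord (fun _ => 4 * (r + r₀)) L dev₀ * dev₀ ≤ ε₀) {u : GaugeField P j G}
    (hu : u ∈ dom) (hd : dev u ≤ dev₀) :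
    u ∈ tiltDom s (relDensity s vΛ fun U => relWindow s vΛ (sharpWindow s r) U * Real.exp (-(β * wilsonAction w U)))
      u₀ (fun u => rkappa s (fun _ => β * w) plaqWord u u₀ (vΛ u) (vΛ u₀))
      (fun u => tiltSlope s (fun _ => β * w) plaqWord (fun _ => 4 * (r + r₀)) L dev₀ * dev u) ε₀ := by
  have hη0 : ∀ _p : Plaq P j, 0 ≤ 4 * (r + r₀) := fun _ => by linarith
  have hc := reps_le_ceiling s (fun _ => β * w) plaqWord hη0 hL hbg hext hdev hε₀ hu hd
  exact mem_tiltDom_of_eps_le s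
    (ε' := fun u => tiltSlope s (fun _ => β * w) plaqWord (fun _ => 4 * (r + r₀)) L dev₀ * dev u)
    (relDensity_nonneg s vΛ fun U => mul_nonneg (sharpWindow_nonneg s r _) (Real.exp_pos _).le)
    (mem_tiltDom_relFibreWindow_wilson hq s hv hr hr0 β w hbg₀ hext₀ hc.2)
    (reps_le_tiltSlope_mul_dev s (fun _ => β * w) plaqWord hη0 hL hbg hext hdev hu hd) hc.1

open Literature.MathematicalPhysics.QuantumLattice in
/-- **… IN `SU(n)`** (`ReTrQuad` discharged by pv28's `reTrQuad_specialUnitaryGroup`): the only non-numeric hypotheses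
left are `FieldIndep s vΛ` (U1a), `BgDev` (BGDEV* (R)) and `ExtDev` (the gauge identification); nothing printed is
asserted. [folklore] -/
theorem mem_tiltDom_relFibreWindow_wilson_SU_linear {n : Type*} [Fintype n] [DecidableEq n] [Nonempty n]
    (s : Finset (PBond P j))
    {vΛ : GaugeField P j (Matrix.specialUnitaryGroup n ℂ) → GaugeField P j (Matrix.specialUnitaryGroup n ℂ)}
    (hv : FieldIndep s vΛ) {r r₀ : ℝ} (hr : 0 ≤ r) (hr0 : 0 ≤ r₀) (β w : ℝ)
    {dom : Set (GaugeField P j (Matrix.specialUnitaryGroup n ℂ))}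
    {u₀ : GaugeField P j (Matrix.specialUnitaryGroup n ℂ)}
    {dev : GaugeField P j (Matrix.specialUnitaryGroup n ℂ) → ℝ} {L dev₀ ε₀ : ℝ} (hL : 0 ≤ L)
    (hbg : BgDev s vΛ dom u₀ dev L) (hext : ExtDev s plaqWord dom u₀ dev L) (hdev : ∀ u ∈ dom, 0 ≤ dev u)
    (hbg₀ : ∀ b ∈ s, dist1 (vΛ u₀ b) ≤ r₀)
    (hext₀ : ∀ p : Plaq P j, Meets s (plaqWord p) → ∀ c ∈ plaqWord p, c.1 ∉ s → dist1 (u₀ c.1) ≤ r)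
    (hε₀ : tiltSlope s (fun _ => β * w) plaqWord (fun _ => 4 * (r + r₀)) L dev₀ * dev₀ ≤ ε₀)
    {u : GaugeField P j (Matrix.specialUnitaryGroup n ℂ)} (hu : u ∈ dom) (hd : dev u ≤ dev₀) :
    u ∈ tiltDom s (relDensity s vΛ fun U => relWindow s vΛ (sharpWindow s r) U * Real.exp (-(β * wilsonAction w U)))
      u₀ (fun u => rkappa s (fun _ => β * w) plaqWord u u₀ (vΛ u) (vΛ u₀))
      (fun u => tiltSlope s (fun _ => β * w) plaqWord (fun _ => 4 * (r + r₀)) L dev₀ * dev u) ε₀ :=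
  mem_tiltDom_relFibreWindow_wilson_linear reTrQuad_specialUnitaryGroup s hv hr hr0 β w hL hbg hext hdev hbg₀ hext₀
    hε₀ hu hd

omit [GaugeGroup G] in
/-- NON-VACUITY of the linear tilt domain: the reference exterior lies in it whenever `κ u₀ = 0`, `dev u₀ = 0`,
`0 ≤ ε₀` (`T4TiltModulus.self_mem_tiltDom`). [folklore] -/
theorem self_mem_tiltDom_linear (s : Finset (PBond P j)) (old : Density P j G) (u₀ : GaugeField P j G)
    {κ dev : GaugeField P j G → ℝ} {C ε₀ : ℝ} (hκ : κ u₀ = 0) (hdev : dev u₀ = 0) (hε₀ : 0 ≤ ε₀) :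
    u₀ ∈ tiltDom s old u₀ κ (fun u => C * dev u) ε₀ :=
  self_mem_tiltDom s old u₀ hκ (by simp only [hdev, mul_zero]) hε₀

end Membership

/-! ## §3  The consumer moduli of the (β)-node in the DEVIATION currency -/

section Consumer

variable {P : Params} {j : ℕ} {G : Type*} [GaugeGroup G] [MeasurableSpace G] [HaarData G] [MeasurableMul G]
variable {ι : Type*} [Fintype ι] [DecidableEq (PBond P j)]

/-- RESCALING `MeanLipschitz` from the tilt currency `ε` to the deviation currency `dev`: `ε ≤ C·dev` on a
sub-domain turns `lip` into `lip·C` (`0 ≤ lip`). [folklore] -/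
theorem meanLipschitz_rescale {𝒰 β E : Type*} [NormedAddCommGroup E] {dom dom' : Set 𝒰} {m : 𝒰 → β → E}
    {S : Finset β} {u₀ : 𝒰} {ε dev : 𝒰 → ℝ} {lip C : ℝ} (h : MeanLipschitz dom m S u₀ ε lip) (hlip : 0 ≤ lip)
    (hsub : dom' ⊆ dom) (hε : ∀ u ∈ dom', ε u ≤ C * dev u) : MeanLipschitz dom' m S u₀ dev (lip * C) := by
  intro u hu b hb
  refine (h u (hsub hu) b hb).trans ?_
  rw [mul_assoc]
  exact mul_le_mul_of_nonneg_left (hε u hu) hlip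

/-- **(β)-NODE, RELATIVE INSERTS — NO (B-INS) CHARGE (row RELSIZE° (2), D-free half).**  For the Gibbs density
`old = χ·e^{h}` (raw density measurable, `≤ C`, printed proviso `fibreIntegral ≠ 0` at `u₀`), a fibre-independent
background, a window exterior-blind along relative fibres on `dom` with smallness `η` at `u₀`, the deviation
hypotheses `BgDev`/`ExtDev` (`L`) and `tiltSlope · dev₀ ≤ ε₀`: the conditional mean field of pv16's relative inserts
`u ↦ b ↦ ∫ relInsert B u (·) b ∂condLaw s old u` is `MeanLipschitz` on `dom ∩ {dev ≤ dev₀}` IN THE DEVIATION CURRENCY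
`dev` with `lip = 2e^{2ε₀}·M·tiltSlope` (pv16's `meanLipschitz_of_relTilt` BY NAME on the linear tilt domain).
[folklore] -/
theorem meanLipschitz_relInsert_of_bgDev {E : Type*} [NormedAddCommGroup E] [NormedSpace ℝ E] [CompleteSpace E]
    {β : Type*} (hq : ReTrQuad G) (s : Finset (PBond P j)) {vΛ : GaugeField P j G → GaugeField P j G}
    (hv : FieldIndep s vΛ) {χ : Density P j G} (hχ0 : ∀ U, 0 ≤ χ U) (c : ι → ℝ) (word : ι → List (Letter P j))
    {η : ι → ℝ} (hη0 : ∀ i, 0 ≤ η i) {dom : Set (GaugeField P j G)} {u₀ : GaugeField P j G}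
    {dev : GaugeField P j G → ℝ} {L dev₀ ε₀ : ℝ} (hL : 0 ≤ L) (hbg : BgDev s vΛ dom u₀ dev L)
    (hext : ExtDev s word dom u₀ dev L) (hdev : ∀ u ∈ dom, 0 ≤ dev u) (hW : SmallOnRelWindow s vΛ χ word η u₀)
    (hε₀ : tiltSlope s c word η L dev₀ * dev₀ ≤ ε₀)
    (hχ : ∀ u ∈ dom, ∀ y : s → G,
      χ (updateFinset u s (y * onFibre s (vΛ u))) = χ (updateFinset u₀ s (y * onFibre s (vΛ u₀))))
    (hm : Measurable fun U => χ U * Real.exp (hsum c word U)) {C : ℝ} (hC : ∀ U, χ U * Real.exp (hsum c word U) ≤ C)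
    (hne : fibreIntegral s (fun U => χ U * Real.exp (hsum c word U)) u₀ ≠ 0)
    {B : (s → G) → β → E} {S : Finset β} (hB : ∀ b ∈ S, AEStronglyMeasurable (fun y => B y b) (fibreBase s))
    {c₀ : β → E} {M : ℝ} (hM : ∀ b ∈ S, ∀ y, ‖B y b - c₀ b‖ ≤ M) :
    MeanLipschitz (dom ∩ {u | dev u ≤ dev₀})
      (fun u b => ∫ y, relInsert s vΛ B u y b ∂condLaw s (fun U => χ U * Real.exp (hsum c word U)) u) S u₀ dev
      (2 * Real.exp (2 * ε₀) * M * tiltSlope s c word η L dev₀) := by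
  intro u hu b hb
  obtain ⟨hu, hd⟩ := hu
  have hmem := mem_tiltDom_rel_hsum_linear hq s hv hχ0 c word hη0 hL hbg hext hdev hW hε₀ hu hd (hχ u hu)
  have h := meanLipschitz_of_relTilt s hv hm (fun U => mul_nonneg (hχ0 U) (Real.exp_pos _).le) hC hne hB hM
    u hmem b hb
  calc _ ≤ 2 * Real.exp (2 * ε₀) * M * (tiltSlope s c word η L dev₀ * dev u) := h
    _ = 2 * Real.exp (2 * ε₀) * M * tiltSlope s c word η L dev₀ * dev u := by ring

/-- … hence, with `MeanVanishes` at the reference exterior (row (α)/K, NOT touched), `CondMeanSuppression` of the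
relative inserts on `dom ∩ {dev ≤ dev₀}` in the deviation currency (`condMeanSuppression_of_flat`). [folklore] -/
theorem condMeanSuppression_relInsert_of_bgDev {E : Type*} [NormedAddCommGroup E] [NormedSpace ℝ E]
    [CompleteSpace E] {β : Type*} (hq : ReTrQuad G) (s : Finset (PBond P j))
    {vΛ : GaugeField P j G → GaugeField P j G} (hv : FieldIndep s vΛ) {χ : Density P j G} (hχ0 : ∀ U, 0 ≤ χ U)
    (c : ι → ℝ) (word : ι → List (Letter P j)) {η : ι → ℝ} (hη0 : ∀ i, 0 ≤ η i) {dom : Set (GaugeField P j G)}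
    {u₀ : GaugeField P j G} {dev : GaugeField P j G → ℝ} {L dev₀ ε₀ : ℝ} (hL : 0 ≤ L)
    (hbg : BgDev s vΛ dom u₀ dev L) (hext : ExtDev s word dom u₀ dev L) (hdev : ∀ u ∈ dom, 0 ≤ dev u)
    (hW : SmallOnRelWindow s vΛ χ word η u₀) (hε₀ : tiltSlope s c word η L dev₀ * dev₀ ≤ ε₀)
    (hχ : ∀ u ∈ dom, ∀ y : s → G,
      χ (updateFinset u s (y * onFibre s (vΛ u))) = χ (updateFinset u₀ s (y * onFibre s (vΛ u₀))))
    (hm : Measurable fun U => χ U * Real.exp (hsum c word U)) {C : ℝ} (hC : ∀ U, χ U * Real.exp (hsum c word U) ≤ C)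
    (hne : fibreIntegral s (fun U => χ U * Real.exp (hsum c word U)) u₀ ≠ 0)
    {B : (s → G) → β → E} {S : Finset β} (hB : ∀ b ∈ S, AEStronglyMeasurable (fun y => B y b) (fibreBase s))
    {c₀ : β → E} {M : ℝ} (hM : ∀ b ∈ S, ∀ y, ‖B y b - c₀ b‖ ≤ M)
    (hflat : MeanVanishes S fun b =>
      ∫ y, relInsert s vΛ B u₀ y b ∂condLaw s (fun U => χ U * Real.exp (hsum c word U)) u₀) :
    CondMeanSuppression (dom ∩ {u | dev u ≤ dev₀})
      (fun u b => ∫ y, relInsert s vΛ B u y b ∂condLaw s (fun U => χ U * Real.exp (hsum c word U)) u) S dev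
      (2 * Real.exp (2 * ε₀) * M * tiltSlope s c word η L dev₀) :=
  condMeanSuppression_of_flat
    (hL := meanLipschitz_relInsert_of_bgDev hq s hv hχ0 c word hη0 hL hbg hext hdev hW hε₀ hχ hm hC hne hB hM) hflat

/-- **(β)-NODE, RAW FIBRE-LIPSCHITZ INSERTS — THE D-CHARGED MODULUS IN THE DEVIATION CURRENCY (row RELSIZE° (2)).**
Same data, for bond inserts `y ↦ B y b` FIXED IN THE RAW fibre variable and fibre-Lipschitz (`FibreLip`, constant
`LF ≥ 0`): `MeanLipschitz` on `dom ∩ {dev ≤ dev₀}` with `dev := dev` and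
`lip = 2e^{2ε₀}·M·tiltSlope + LF·|s|·L` — pv16's «`2e^{2ε₀}M + L′`» of `meanLipschitz_of_relTilt_raw` read through
`ε ≤ tiltSlope·dev`, with `L′ = LF·|s|·L` pv04's (B-INS) constant (`norm_integral_condLaw_sub_le_of_bgDev` BY NAME,
ratio-closeness from pv28's `fibreRatioClose_rel_hsum`, linearisation `exp_two_mul_sub_one_le`).  LOCATED, not a
defect: pv16's `meanLipschitz_of_relTilt_raw` is not instantiated by name — its `hD` binder quantifies over the whole
tilt domain in the currency `ε u`, `BgDev` over `dom` in the currency `dev u`; the present statement is the honest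
composition. [folklore] -/
theorem meanLipschitz_raw_of_bgDev {E : Type*} [NormedAddCommGroup E] [NormedSpace ℝ E] [CompleteSpace E]
    {β : Type*} (hq : ReTrQuad G) (s : Finset (PBond P j)) {vΛ : GaugeField P j G → GaugeField P j G}
    (hv : FieldIndep s vΛ) {χ : Density P j G} (hχ0 : ∀ U, 0 ≤ χ U) (c : ι → ℝ) (word : ι → List (Letter P j))
    {η : ι → ℝ} (hη0 : ∀ i, 0 ≤ η i) {dom : Set (GaugeField P j G)} {u₀ : GaugeField P j G}
    {dev : GaugeField P j G → ℝ} {L dev₀ ε₀ : ℝ} (hL : 0 ≤ L) (hbg : BgDev s vΛ dom u₀ dev L)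
    (hext : ExtDev s word dom u₀ dev L) (hdev : ∀ u ∈ dom, 0 ≤ dev u) (hW : SmallOnRelWindow s vΛ χ word η u₀)
    (hε₀ : tiltSlope s c word η L dev₀ * dev₀ ≤ ε₀)
    (hχ : ∀ u ∈ dom, ∀ y : s → G,
      χ (updateFinset u s (y * onFibre s (vΛ u))) = χ (updateFinset u₀ s (y * onFibre s (vΛ u₀))))
    (hm : Measurable fun U => χ U * Real.exp (hsum c word U)) {C : ℝ} (hC : ∀ U, χ U * Real.exp (hsum c word U) ≤ C)
    (hne : fibreIntegral s (fun U => χ U * Real.exp (hsum c word U)) u₀ ≠ 0)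
    {B : (s → G) → β → E} {S : Finset β} (hB : ∀ b ∈ S, AEStronglyMeasurable (fun y => B y b) (fibreBase s))
    {c₀ : β → E} {M : ℝ} (hM : ∀ b ∈ S, ∀ y, ‖B y b - c₀ b‖ ≤ M) {LF : ℝ}
    (hFL : ∀ b ∈ S, FibreLip s (fun y => B y b) LF) (hLF : 0 ≤ LF) :
    MeanLipschitz (dom ∩ {u | dev u ≤ dev₀})
      (fun u b => ∫ y, B y b ∂condLaw s (fun U => χ U * Real.exp (hsum c word U)) u) S u₀ dev
      (2 * Real.exp (2 * ε₀) * M * tiltSlope s c word η L dev₀ + LF * s.card * L) := by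
  intro u hu b hb
  obtain ⟨hu, hd⟩ := hu
  have hMnn : 0 ≤ M := (norm_nonneg _).trans (hM b hb (fun _ => 1))
  have hR := fibreRatioClose_rel_hsum hq s hv hχ0 c word η (hχ u hu) hW
  have h := norm_integral_condLaw_sub_le_of_bgDev s hv hm (fun U => mul_nonneg (hχ0 U) (Real.exp_pos _).le) hC hne
    hR (hB b hb) (hM b hb) (hFL b hb) hLF hbg hu
  have h1 := reps_le_tiltSlope_mul_dev s c word hη0 hL hbg hext hdev hu hd
  have hc := reps_le_ceiling s c word hη0 hL hbg hext hdev hε₀ hu hd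
  have h2 := exp_two_mul_sub_one_le (reps_nonneg s c word hη0 u u₀ (vΛ u) (vΛ u₀)) hc.2
  have h3 : (Real.exp (2 * reps s c word η u u₀ (vΛ u) (vΛ u₀)) - 1) * M
      ≤ 2 * Real.exp (2 * ε₀) * (tiltSlope s c word η L dev₀ * dev u) * M :=
    mul_le_mul_of_nonneg_right (h2.trans (mul_le_mul_of_nonneg_left h1 (by positivity))) hMnn
  calc _ ≤ (Real.exp (2 * reps s c word η u u₀ (vΛ u) (vΛ u₀)) - 1) * M + LF * (s.card * (L * dev u)) := h
    _ ≤ 2 * Real.exp (2 * ε₀) * (tiltSlope s c word η L dev₀ * dev u) * M + LF * (s.card * (L * dev u)) :=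
        add_le_add h3 le_rfl
    _ = (2 * Real.exp (2 * ε₀) * M * tiltSlope s c word η L dev₀ + LF * s.card * L) * dev u := by ring

/-- … hence, with `MeanVanishes` at the reference exterior, `CondMeanSuppression` of the raw fibre-Lipschitz inserts
on `dom ∩ {dev ≤ dev₀}` in the deviation currency. [folklore] -/
theorem condMeanSuppression_raw_of_bgDev {E : Type*} [NormedAddCommGroup E] [NormedSpace ℝ E] [CompleteSpace E]
    {β : Type*} (hq : ReTrQuad G) (s : Finset (PBond P j)) {vΛ : GaugeField P j G → GaugeField P j G}
    (hv : FieldIndep s vΛ) {χ : Density P j G} (hχ0 : ∀ U, 0 ≤ χ U) (c : ι → ℝ) (word : ι → List (Letter P j))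
    {η : ι → ℝ} (hη0 : ∀ i, 0 ≤ η i) {dom : Set (GaugeField P j G)} {u₀ : GaugeField P j G}
    {dev : GaugeField P j G → ℝ} {L dev₀ ε₀ : ℝ} (hL : 0 ≤ L) (hbg : BgDev s vΛ dom u₀ dev L)
    (hext : ExtDev s word dom u₀ dev L) (hdev : ∀ u ∈ dom, 0 ≤ dev u) (hW : SmallOnRelWindow s vΛ χ word η u₀)
    (hε₀ : tiltSlope s c word η L dev₀ * dev₀ ≤ ε₀)
    (hχ : ∀ u ∈ dom, ∀ y : s → G,
      χ (updateFinset u s (y * onFibre s (vΛ u))) = χ (updateFinset u₀ s (y * onFibre s (vΛ u₀))))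
    (hm : Measurable fun U => χ U * Real.exp (hsum c word U)) {C : ℝ} (hC : ∀ U, χ U * Real.exp (hsum c word U) ≤ C)
    (hne : fibreIntegral s (fun U => χ U * Real.exp (hsum c word U)) u₀ ≠ 0)
    {B : (s → G) → β → E} {S : Finset β} (hB : ∀ b ∈ S, AEStronglyMeasurable (fun y => B y b) (fibreBase s))
    {c₀ : β → E} {M : ℝ} (hM : ∀ b ∈ S, ∀ y, ‖B y b - c₀ b‖ ≤ M) {LF : ℝ}
    (hFL : ∀ b ∈ S, FibreLip s (fun y => B y b) LF) (hLF : 0 ≤ LF)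
    (hflat : MeanVanishes S fun b => ∫ y, B y b ∂condLaw s (fun U => χ U * Real.exp (hsum c word U)) u₀) :
    CondMeanSuppression (dom ∩ {u | dev u ≤ dev₀})
      (fun u b => ∫ y, B y b ∂condLaw s (fun U => χ U * Real.exp (hsum c word U)) u) S dev
      (2 * Real.exp (2 * ε₀) * M * tiltSlope s c word η L dev₀ + LF * s.card * L) :=
  condMeanSuppression_of_flat
    (hL := meanLipschitz_raw_of_bgDev hq s hv hχ0 c word hη0 hL hbg hext hdev hW hε₀ hχ hm hC hne hB hM hFL hLF)
    hflat

end Consumer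

/-! ## §4  Non-vacuity: the raw toy `vΛ ≡ 1` — the SAME tiltSlope sizes pv28's raw `eps` -/

section RawToy

variable {P : Params} {j : ℕ} {G : Type*} [GaugeGroup G] {ι : Type*} [Fintype ι] [DecidableEq (PBond P j)]

/-- THE RAW SIZING (row RELSIZE° (3)): under a letterwise exterior bound `dist1 (u₀(b)⁻¹u(b)) ≤ L·d` on the exterior
letters of the words meeting `s` (`0 ≤ L`, `0 ≤ d ≤ dev₀`), pv28's raw `eps ≤ tiltSlope · d` with THE SAME `tiltSlope` —
G7-LOG*'s `eps_le_of_bdev_le` with `D := L·d` and the quadratic term linearised; obtained here from the RELATIVE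
sizing at equal backgrounds (`reps_bg_self`, `rbdev_bg_self`): the composition costs nothing at `vΛ ≡ 1`.
[folklore] -/
theorem eps_le_tiltSlope_mul (s : Finset (PBond P j)) (c : ι → ℝ) (word : ι → List (Letter P j)) {η : ι → ℝ}
    (hη0 : ∀ i, 0 ≤ η i) (u u₀ : GaugeField P j G) {L d dev₀ : ℝ} (hL : 0 ≤ L) (hd : 0 ≤ d) (hd₀ : d ≤ dev₀)
    (hD : ∀ i, Meets s (word i) → ∀ c' ∈ word i, c'.1 ∉ s → dist1 (bdev u u₀ c'.1) ≤ L * d) :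
    eps s c word η u u₀ ≤ tiltSlope s c word η L dev₀ * d := by
  rw [← reps_bg_self s c word η u u₀ (1 : GaugeField P j G)]
  refine reps_le_tiltSlope_mul s c word hη0 u u₀ 1 1 hL hd hd₀ fun i hi c' hc' => ?_
  exact rbdev_le_of_bdev_le s u u₀ 1 1 (fun h => hD i hi c' hc' h) fun _ => by
    change dist1 ((1 : G)⁻¹ * 1) ≤ L * d
    rw [inv_one, one_mul, GaugeGroup.dist1_one]
    exact mul_nonneg hL hd

/-- **THE RAW TOY OF THE LINEAR MEMBERSHIP** (`vΛ ≡ 1`: `relDensity_one`, `rkappa_bg_self`, `bgDev_one`): for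
`old = χ·e^{h}` with an exterior-blind window (`hχ`, raw (S-TILT)) and raw window smallness `SmallOnWindow` at `u₀`,
`ExtDev s word dom u₀ dev L` ALONE gives membership of every `u ∈ dom`, `dev u ≤ dev₀`, in pv16-g9's RAW tilt domain
`tiltDom s old u₀ kappa (fun u => tiltSlope · dev u) ε₀` — the background hypothesis is void and the slope is the raw
one. [folklore] -/
theorem mem_tiltDom_hsum_linear_raw (hq : ReTrQuad G) (s : Finset (PBond P j)) {χ : Density P j G}
    (hχ0 : ∀ U, 0 ≤ χ U) (c : ι → ℝ) (word : ι → List (Letter P j)) {η : ι → ℝ} (hη0 : ∀ i, 0 ≤ η i)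
    {dom : Set (GaugeField P j G)} {u₀ : GaugeField P j G} {dev : GaugeField P j G → ℝ} {L dev₀ ε₀ : ℝ}
    (hL : 0 ≤ L) (hext : ExtDev s word dom u₀ dev L) (hdev : ∀ u ∈ dom, 0 ≤ dev u)
    (hW : SmallOnWindow s χ word η u₀) (hε₀ : tiltSlope s c word η L dev₀ * dev₀ ≤ ε₀) {u : GaugeField P j G}
    (hu : u ∈ dom) (hd : dev u ≤ dev₀) (hχ : ∀ y : s → G, χ (updateFinset u s y) = χ (updateFinset u₀ s y)) :
    u ∈ tiltDom s (fun U => χ U * Real.exp (hsum c word U)) u₀ (fun u => kappa s c word u u₀)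
      (fun u => tiltSlope s c word η L dev₀ * dev u) ε₀ := by
  have hbg : BgDev s (fun _ => (1 : GaugeField P j G)) dom u₀ dev L := (bgDev_one s dom u₀ dev).mono hL hdev
  have hW' : SmallOnRelWindow s (fun _ => (1 : GaugeField P j G)) χ word η u₀ := fun y hy => hW _ hy
  have h := mem_tiltDom_rel_hsum_linear hq s (FieldIndep.const s (1 : GaugeField P j G)) hχ0 c word hη0 hL hbg hext
    hdev hW' hε₀ hu hd (fun y => hχ _)
  simpa only [relDensity_one, rkappa_bg_self] using h

/-- **NON-VACUITY OF THE WHOLE CHAIN** in the raw toy with the total exterior deviation as gauge (`L = 1`,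
`dom = univ`, `ExtDev` by `extDev_totDev`, `BgDev` void): EVERY exterior `u` with `totDev u₀ u ≤ dev₀` and the window
exterior-blind between `u` and `u₀` lies in the raw tilt domain with `ε = tiltSlope … 1 dev₀ · totDev u₀ u`; only the
window smallness at `u₀` and the numeric side condition `tiltSlope · dev₀ ≤ ε₀` remain as hypotheses. [folklore] -/
theorem mem_tiltDom_hsum_linear_totDev (hq : ReTrQuad G) (s : Finset (PBond P j)) {χ : Density P j G}
    (hχ0 : ∀ U, 0 ≤ χ U) (c : ι → ℝ) (word : ι → List (Letter P j)) {η : ι → ℝ} (hη0 : ∀ i, 0 ≤ η i)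
    {u₀ : GaugeField P j G} {dev₀ ε₀ : ℝ} (hW : SmallOnWindow s χ word η u₀)
    (hε₀ : tiltSlope s c word η 1 dev₀ * dev₀ ≤ ε₀) {u : GaugeField P j G} (hd : totDev u₀ u ≤ dev₀)
    (hχ : ∀ y : s → G, χ (updateFinset u s y) = χ (updateFinset u₀ s y)) :
    u ∈ tiltDom s (fun U => χ U * Real.exp (hsum c word U)) u₀ (fun u => kappa s c word u u₀)
      (fun u => tiltSlope s c word η 1 dev₀ * totDev u₀ u) ε₀ :=
  mem_tiltDom_hsum_linear_raw hq s hχ0 c word hη0 zero_le_one (extDev_totDev s word Set.univ u₀)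
    (fun u _ => totDev_nonneg u₀ u) hW hε₀ (Set.mem_univ u) hd hχ

end RawToy

end Literature.MathematicalPhysics.QuantumFieldTheory.Balaban1983to89.T4RelativeTiltSize

end
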